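import Summits.ResolutionOfSingularities.ResolutionOfSingularities.Theorems.FrobeniusClosingPatchingRelPerfectDepthSepFormatHolds
import Summits.ResolutionOfSingularities.ResolutionOfSingularities.Theorems.FrobeniusClosingPatchingRelPerfectDepthFlagSepCompositions
import Summits.ResolutionOfSingularities.ResolutionOfSingularities.Theorems.FrobeniusClosingPatchingRelPerfectDepthPointwisePairGameHolds
import HarnessLib

/-!
# Chain W5.2 — F6 STAGE 2: the weight-one TOWER and the stage-2 ENGINE CLOSED BY NAME for `Q := SepFormat`

[OURS · L1 W5.2 · res-D-pv-016 AS res-L1-w52-stub-5 (res-L1-w52-plan-1 STEER 4 2026-08-27T11:07:07Z (2)); by-name compositions over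
TargetsF6 module 2 `…DepthSepTargets` / module 3 `…DepthFlagSepCompositions` (res-D-pv-059 AS lead-2).]  NOT statements of the
manuscript under review; AI-written, weaker than expert review; fact-free except through the explicit binders of
`sepEngine_threefold_sepFormat` (`SeparationBoundaryNil₃`, F-32bR `CossartJannsenSaito2020EmbeddedSequenceB`).

* `towerSep_sepFormat : TowerSep SepFormat` := `towerSep_of_stepSepOne stepSepOne_sepFormat` (the formatted weight-one step
  `…DepthSepFormatHolds` iterated along any E-side `IsSepSeq`);
* `sepEngine_sepFormat : SepEngine SepFormat` := `sepEngine_of_targets` over the tower, `endTwoMonomialSep_sepFormat` and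
  res-L1-w52-stub-1's `pointwisePairGame_holds` — the stage-2 ENGINE at the format of record, UNCONDITIONAL;
* `sepEngine_threefold_sepFormat` := `sepEngine_threefold` at `Q := SepFormat` — the engine on integral Noetherian regular excellent
  threefolds at the empty boundary, modulo the E-side driver `SeparationBoundaryNil₃` (T6-E2) and F-32bR only.

[cite: BierstoneGrigorievMilmanWlodarczyk2011, §3.2 Lemma 3.2.1, §4 Step 2] [cite: Kollar2007, (3.111) Step 3, 3.30.2]
[cite: CossartJannsenSaito2020, Thm. 1.4]
-/

-- `Summit.<Summit>.<Sub>.Theorems` with `Sub = Summit` (single-conjunct summit, D-0017)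
set_option linter.dupNamespace false

noncomputable section

open CategoryTheory CategoryTheory.Limits AlgebraicGeometry TopologicalSpace IsLocalRing
open Literature.AlgebraicGeometry.Resolution

namespace Summit.ResolutionOfSingularities.ResolutionOfSingularities.Theorems.DepthTargets

universe u

/-- [OURS · L1 W5.2] **`TowerSep SepFormat`** — the weight-one TOWER of stage 2 holds for the format of record: every E-side
`IsSepSeq` is matched by a weighted X-side sequence carrying the invariant and `SepFormat` (iterate `stepSepOne_sepFormat`).
[cite: BierstoneGrigorievMilmanWlodarczyk2011, §3.2 Lemma 3.2.1] [cite: Kollar2007, 3.30.2] -/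
theorem towerSep_sepFormat : TowerSep DepthGraded.SepFormat.{u} :=
  towerSep_of_stepSepOne stepSepOne_sepFormat

/-- [OURS · L1 W5.2] **`SepEngine SepFormat`** — the STAGE-2 ENGINE at the format of record, unconditional: at any state of the
depth-two monomial-contact invariant in format `SepFormat` whose E-side datum admits an `IsSepSeq` reaching `EndSep`, the
conclusion of the CORE holds for every `T = Bl_I Spec S` (tower ⇒ two-monomial END ⇒ pointwise pair game).
[cite: Kollar2007, (3.111) Step 3] [cite: BierstoneGrigorievMilmanWlodarczyk2011, §4 Step 2] -/
theorem sepEngine_sepFormat : SepEngine DepthGraded.SepFormat.{u} :=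
  sepEngine_of_targets _ towerSep_sepFormat endTwoMonomialSep_sepFormat pointwisePairGame_holds

/-- [OURS · L1 W5.2] **The stage-2 engine on excellent regular threefolds at the format of record** — at any `SepFormat` state with
empty boundary whose exceptional scheme is an integral Noetherian regular excellent threefold and whose E-side datum is non-zero and
locally principal, the conclusion of the CORE holds, MODULO the E-side separation driver `SeparationBoundaryNil₃` and F-32bR
(`CossartJannsenSaito2020EmbeddedSequenceB`) — both explicit binders; the X-side is by name (`sepEngine_threefold`).
[cite: CossartJannsenSaito2020, Thm. 1.4] [cite: Kollar2007, (3.111) Step 3] -/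
theorem sepEngine_threefold_sepFormat
    (hSep : SeparationBoundaryNil₃.{u}) (hCJS : CossartJannsenSaito2020EmbeddedSequenceB.{u})
    {S : Type u} [CommRing S] [IsRegularLocalRing S] {I : Ideal S} (hI : I ≠ ⊥)
    {E X : Scheme.{u}} [IsIntegral E] [IsNoetherian E] (hexc : Scheme.IsExcellent E) (hdim : topologicalKrullDim E = 3)
    {i : E ⟶ X} {g : X ⟶ Spec (.of S)} {K N : X.IdealSheafData}
    (hinv : DepthInvariantMono 2 S I E X i g K N) (hQ : DepthGraded.SepFormat i K N ([] : List (E.IdealSheafData × ℕ)))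
    (hK : K.comap i ≠ ⊥) (hlp : IsLocallyPrincipal (K.comap i))
    (T : Scheme.{u}) (f : T ⟶ Spec (.of S)) (hf : IsBlowup f (affineBlowup.idealSheaf I)) :
    ∃ (J : T.IdealSheafData) (T' : Scheme.{u}) (π : T' ⟶ T), J ≠ ⊥ ∧
      (∀ t : T, t ∈ J.support → f.base t = IsLocalRing.closedPoint S) ∧
      IsBlowup π J ∧ Scheme.IsRegular T' :=
  sepEngine_threefold _ towerSep_sepFormat endTwoMonomialSep_sepFormat pointwisePairGame_holds hSep hCJS hI hexc hdim hinv hQ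
    hK hlp T f hf

end Summit.ResolutionOfSingularities.ResolutionOfSingularities.Theorems.DepthTargets

end
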